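import Summits.BirchSwinnertonDyer.BirchSwinnertonDyer.Theorems.SylvesterTwoHeegnerIndexCMDataPairTrace
import Summits.BirchSwinnertonDyer.BirchSwinnertonDyer.Theorems.SylvesterTwoHeegnerIndexCMFlipLevelPairPrep
import Summits.BirchSwinnertonDyer.BirchSwinnertonDyer.Theorems.SylvesterTwoHeegnerIndexCMFlipLevelPrimePrep
import HarnessLib

/-!
# The COUPLED Cassels–Tate telescope, XXIX: (ES1) at a general level `9p(ℓm)` of HSY's tower and the two
# Euler-system inputs of the FLIP core — `Σ_{i≤ℓ} σ^i z = 0` and the conjugate-wise (ES2) relation — propagated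
# through a derivative operator (RESIDUE c v3 (T-L1), glue for `flip_core_sylvesterTower`'s `htrz` / `hES`)

Crux `UpperOffV0HSYPlus` (stmt-BirchSwinnertonDyer-19804).  `SylvesterTwoCMFlip.flip_core_sylvesterTower`
(`…CoupledTelescopeFlipCore`, p726952) displays, for the points `z = D_m y_{ℓm}`, `z₀ = D_m y_m` of the
rows, `htrz : Σ_{i ≤ ℓ} σ^i z = 0` and `hES : ∀ φ₀ g, red(g • ι z) = φ₀ • red(g • ι z₀)`.  This file supplies:
* ★ `sum_pointGalHom_eq_lFunction_smul_sylvesterTower_left` — (ES1) at `ℓ` over `K[9pm]` INSIDE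
  `E(K[9p(ℓm)])`, the level written `9·p·(ℓ·m)` (the tree's `…_sylvesterTower` writes `9·p·(n·ℓ)`; #R-e1
  `…_sylvester_pair_left` is the case `m = ℓ'` prime): `Σ_{g ∈ G_ℓ} g • y_{ℓm} = a_ℓ • y_m`, for any `m ≠ 0`
  with prime factors `≡ 2 (3)`, from `HeegnerTraceOrders.sum_pointGalHom_eq_lFunction_smul_of_fix` exactly as
  #R-e1 does;
* ★ `sum_pointGalHom_pow_eq_zero_sylvesterTower` — for `W₀ = (y² + y = x³ − 1)` (`a_ℓ(W₀) = 0` at `ℓ ≡ 2 (3)`)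
  and a generator `σ` of `G_ℓ = Gal(K[9p(ℓm)]/K[9pm])`: `Σ_{i ≤ ℓ} σ^i y_{ℓm} = 0`;
* `sum_pointGalHom_pow_derivOp_eq_zero` — `Σ_i σ^i w = 0 ⟹ Σ_i σ^i (D_{σ'} w) = 0` for commuting `σ, σ'`
  (iterate over the factors of `D_m`);
* `forall_geomReduction_derivOp_of_forall` — the conjugate-wise (ES2) relation `∀ γ ∈ S, ∀ g,
  red(g • ι(γ y)) = φ₀ • red(g • ι(γ y₀))` for a set `S` of automorphisms stable under `(σ' ^ k) * ·` and
  commuting with `σ'` passes to `(D_{σ'} y, D_{σ'} y₀)` (iterate; `S = Gal(K[9p(ℓm)]/K)` is abelian, x11b3).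
Theorems only (no definition / named fact / instance / notation); nothing asserted on 19804; no stub closed;
X12.CMAtTwo NOT proved; BSD not claimed for any curve.  Sources: [GrossLMS1991] §3 (3.4)–(3.5), Prop. 3.7 (1),
Prop. 6.2 (2) (proof); [Nekovar2007] Prop. 4.13 (i), Prop. 4.9; [HuShuYin2019] §4.1.
`lean search 'sylvesterTower_left|pow_derivOp_eq_zero'` → nothing before this file.
-/

set_option linter.dupNamespace false -- Summits modules are `Summit.<Summit>.<Problem>…` by design
set_option autoImplicit false

noncomputable section

open scoped Classical

namespace Summit.BirchSwinnertonDyer.BirchSwinnertonDyer.Theorems.SylvesterTwoCMFlip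

open Complex UpperHalfPlane NumberField WeierstrassCurve Finset
open Literature.NumberTheory.EllipticCurves Literature.NumberTheory.EllipticCurves.ModularForms
  Literature.NumberTheory.EllipticCurves.HuShuYin2019
  Literature.NumberTheory.QuadraticFields.BinaryQuadraticForm
  Literature.NumberTheory.QuadraticFields.Quadratic
  Literature.NumberTheory.QuadraticFields Literature.NumberTheory.QuadraticFields.RingClass
  Literature.NumberTheory.EllipticCurves.KolyvaginEuler
  Summit.BirchSwinnertonDyer.BirchSwinnertonDyer.Theorems.SylvesterTwoCMData
  Summit.BirchSwinnertonDyer.Rank1Residual.X11b.RingClassTower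
  Summit.BirchSwinnertonDyer.Rank1Residual.X11b

variable {K : Type} [Field K] [NumberField K]

/-- ★ **(ES1) at `ℓ` over `K[9pm]`, inside `E(K[9p(ℓm)])`: `Σ_{g ∈ G_ℓ} g • y_{ℓm} = a_ℓ • y_m`**
(`G_ℓ = Gal(K[9p(ℓm)]/K[9pm])`; `y_{ℓm}` over `φ(τ_{Q^{(ℓm)}})`, `y_m` over `φ(τ_{Q^{(m)}})`; any `m ≠ 0` with
prime factors `≡ 2 (3)`, `ℓ ∤ pm`; the level written `9·p·(ℓ·m)`).
[cite: GrossLMS1991, Prop. 3.7 (1) (p. 240)] [cite: Nekovar2007, Prop. (4.13) (i)] [cite: HuShuYin2019, §4.1] -/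
theorem sum_pointGalHom_eq_lFunction_smul_sylvesterTower_left (hK : IsImaginaryQuadratic K)
    (hdK : NumberField.discr K = -3) (ι : K →+* ℂ) {W : WeierstrassCurve ℚ}
    (Dt : ModularParametrizationData W 243) {p ℓ m : ℕ} (hp : p % 3 = 1) (hℓ : ℓ.Prime)
    (hℓ3 : ℓ % 3 = 2) (hm : m ≠ 0) (hm3 : ∀ q ∈ m.primeFactors, q % 3 = 2) (hℓm : ¬ ℓ ∣ m) (hℓp : ¬ ℓ ∣ p)
    (hinert : (Ideal.span {(ℓ : 𝓞 K)}).IsPrime)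
    {G : Finset (ringClassField K ι (9 * p * (ℓ * m)) ≃ₐ[ℚ] ringClassField K ι (9 * p * (ℓ * m)))}
    (hG : ∀ g, g ∈ G ↔ g ∈ ringClassGalOver ι (9 * p * (ℓ * m)) (9 * p * m))
    {y y₀ : (W.baseChange (ringClassField K ι (9 * p * (ℓ * m)))).toAffine.Point}
    (hy : Affine.Point.map (W' := W) (ringClassField K ι (9 * p * (ℓ * m))).subtype.toRatAlgHom y = Dt.φ (heegnerTau (((ℓ * m : ℕ) : ℤ) ^ 2 * (81 * ((p : ℤ) ^ 2 + 4 * p + 16)), ((ℓ * m : ℕ) : ℤ) * (-(9 * (4 * (p : ℤ) ^ 2 + 17 * p + 72))), 4 * (p : ℤ) ^ 2 + 18 * p + 81)))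
    (hy₀ : Affine.Point.map (W' := W) (ringClassField K ι (9 * p * (ℓ * m))).subtype.toRatAlgHom y₀ = Dt.φ (heegnerTau ((m : ℤ) ^ 2 * (81 * ((p : ℤ) ^ 2 + 4 * p + 16)), (m : ℤ) * (-(9 * (4 * (p : ℤ) ^ 2 + 17 * p + 72))), 4 * (p : ℤ) ^ 2 + 18 * p + 81))) :
    ∑ g ∈ G, pointGalHom W (ringClassField K ι (9 * p * (ℓ * m))) g y = W.LFunction ℓ • y₀ := by
  haveI : NeZero (243 : ℕ) := ⟨by norm_num⟩
  have hp0 : p ≠ 0 := by rintro rfl; simp at hp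
  have hℓ3' : ℓ ≠ 3 := by rintro rfl; simp at hℓ3
  have hℓN : ¬ ℓ ∣ 243 := by
    intro h
    have h' : ℓ ∣ 3 ^ 5 := by norm_num; exact h
    exact hℓ3' ((Nat.prime_dvd_prime_iff_eq hℓ Nat.prime_three).mp (hℓ.dvd_of_dvd_pow h'))
  have hℓf : ¬ ℓ ∣ 9 * p * m := by
    rw [show 9 * p * m = 3 ^ 2 * (p * m) by ring]
    intro h
    rcases (Nat.Prime.dvd_mul hℓ).mp h with h9 | hpm
    · exact hℓ3' ((Nat.prime_dvd_prime_iff_eq hℓ Nat.prime_three).mp (hℓ.dvd_of_dvd_pow h9))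
    · rcases (Nat.Prime.dvd_mul hℓ).mp hpm with h' | h'
      · exact hℓp h'
      · exact hℓm h'
  have hf : 9 * p * m ≠ 0 := mul_ne_zero (mul_ne_zero (by norm_num) hp0) hm
  have hunits : 2 ≤ 9 * p * m ∨ NumberField.discr K < -4 := by
    left
    have h1 : 1 ≤ p * m := Nat.one_le_iff_ne_zero.mpr (mul_ne_zero hp0 hm)
    have h2 : 9 * p * m = 9 * (p * m) := by ring
    omega
  have hlev : ℓ * (9 * p * m) = 9 * p * (ℓ * m) := by ring
  have h3m : ¬ 3 ∣ m := fun h ↦ by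
    have := hm3 3 (Nat.mem_primeFactors.mpr ⟨Nat.prime_three, h, hm⟩)
    omega
  have hmC : IsCoprime (m : ℤ) (4 * (p : ℤ) ^ 2 + 18 * p + 81) := isCoprime_C_of_forall_prime_mod_three_eq_two (p := p) (n := m) hm hm3
  have hℓmC : IsCoprime ((ℓ * m : ℕ) : ℤ) (4 * (p : ℤ) ^ 2 + 18 * p + 81) :=
    isCoprime_C_of_forall_prime_mod_three_eq_two (p := p) (n := ℓ * m) (mul_ne_zero hℓ.ne_zero hm)
      fun q hq ↦ by
      rw [Nat.primeFactors_mul hℓ.ne_zero hm, Finset.mem_union, hℓ.primeFactors, Finset.mem_singleton] at hq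
      rcases hq with rfl | hq
      · exact hℓ3
      · exact hm3 q hq
  -- base form `Q^{(m)}` and top form `Q^{(ℓm)} = conductorMul ℓ Q^{(m)}`
  have hQ := sylvesterForm_mem_heegnerForms (n := m) hp hm hmC
  have hQ' := sylvesterForm_mem_heegnerForms (n := ℓ * m) hp (mul_ne_zero hℓ.ne_zero hm) hℓmC
  have hQeq : (((ℓ * m : ℕ) : ℤ) ^ 2 * (81 * ((p : ℤ) ^ 2 + 4 * p + 16)), ((ℓ * m : ℕ) : ℤ) * (-(9 * (4 * (p : ℤ) ^ 2 + 17 * p + 72))), 4 * (p : ℤ) ^ 2 + 18 * p + 81) =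
      ((ℓ : ℤ) ^ 2 * ((m : ℤ) ^ 2 * (81 * ((p : ℤ) ^ 2 + 4 * p + 16))), (ℓ : ℤ) * ((m : ℤ) * (-(9 * (4 * (p : ℤ) ^ 2 + 17 * p + 72)))), 4 * (p : ℤ) ^ 2 + 18 * p + 81) := by
    ext <;> push_cast <;> ring
  have hD : ((m : ℤ) ^ 2 * (81 * ((p : ℤ) ^ 2 + 4 * p + 16)), (m : ℤ) * (-(9 * (4 * (p : ℤ) ^ 2 + 17 * p + 72))), 4 * (p : ℤ) ^ 2 + 18 * p + 81).2.1 ^ 2 - 4 * ((m : ℤ) ^ 2 * (81 * ((p : ℤ) ^ 2 + 4 * p + 16)), (m : ℤ) * (-(9 * (4 * (p : ℤ) ^ 2 + 17 * p + 72))), 4 * (p : ℤ) ^ 2 + 18 * p + 81).1 * ((m : ℤ) ^ 2 * (81 * ((p : ℤ) ^ 2 + 4 * p + 16)), (m : ℤ) * (-(9 * (4 * (p : ℤ) ^ 2 + 17 * p + 72))), 4 * (p : ℤ) ^ 2 + 18 * p + 81).2.2 < 0 := by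
    rw [hQ.1]
    have : (0 : ℤ) < ((9 * p * m : ℕ) : ℤ) ^ 2 := by positivity
    linarith
  have hx' : IsHeckeNeighbour 243 ℓ (heegnerTau ((m : ℤ) ^ 2 * (81 * ((p : ℤ) ^ 2 + 4 * p + 16)), (m : ℤ) * (-(9 * (4 * (p : ℤ) ^ 2 + 17 * p + 72))), 4 * (p : ℤ) ^ 2 + 18 * p + 81)) (heegnerTau (((ℓ * m : ℕ) : ℤ) ^ 2 * (81 * ((p : ℤ) ^ 2 + 4 * p + 16)), ((ℓ * m : ℕ) : ℤ) * (-(9 * (4 * (p : ℤ) ^ 2 + 17 * p + 72))), 4 * (p : ℤ) ^ 2 + 18 * p + 81)) := by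
    rw [hQeq]
    exact isHeckeNeighbour_heegnerTau_conductorMul hQ.2.1 hD hℓ
  have hQ'disc : discr (((ℓ * m : ℕ) : ℤ) ^ 2 * (81 * ((p : ℤ) ^ 2 + 4 * p + 16)), ((ℓ * m : ℕ) : ℤ) * (-(9 * (4 * (p : ℤ) ^ 2 + 17 * p + 72))), 4 * (p : ℤ) ^ 2 + 18 * p + 81) = ((9 * p * (ℓ * m) : ℕ) : ℤ) ^ 2 * NumberField.discr K := by
    rw [hdK]; exact hQ'.1
  exact HeegnerTraceOrders.sum_pointGalHom_eq_lFunction_smul_of_fix hK ι Dt hℓ hinert hℓN hℓf hf hunits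
    hlev (fun σ hσ ↦ levelTransport_self_sylvesterPoint_of_fix hK hdK ι hp hm h3m hmC hσ) hQ'.2.1
    ((isPrimitive_iff_binQF _).mpr ((BinQF.isPrimitive_iff _).mpr hQ'.2.2.2)) hQ'disc hx' hG hy hy₀

/-- ★ **`Σ_{i ≤ ℓ} σ^i y_{ℓm} = 0` on `W₀ = (y² + y = x³ − 1)`** for a generator `σ` of
`G_ℓ = Gal(K[9p(ℓm)]/K[9pm])` (`orderOf σ = ℓ + 1`): (ES1) + `a_ℓ(W₀) = 0` (`ℓ ≡ 2 (3)`, `j = 0`).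
[cite: GrossLMS1991, §3 (3.4), Prop. 3.7 (1)] [cite: HuShuYin2019, §4.1] -/
theorem sum_pointGalHom_pow_eq_zero_sylvesterTower {ω : K} (hω : ω ^ 2 + ω + 1 = 0)
    (h2 : Module.finrank ℚ K = 2) (ι : K →+* ℂ) [(⟨0, 0, 1, 0, -1⟩ : WeierstrassCurve ℚ).IsElliptic] [(⟨0, 0, 1, 0, -1⟩ : WeierstrassCurve ℚ).IsGloballyMinimal]
    (Dt : ModularParametrizationData (⟨0, 0, 1, 0, -1⟩ : WeierstrassCurve ℚ) 243) {p ℓ m : ℕ} (hp : p % 3 = 1) [Fact ℓ.Prime]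
    (hℓ3 : ℓ % 3 = 2) (hℓ2 : ℓ ≠ 2) (hΔ : ¬ (ℓ : ℤ) ∣ minimalDiscriminantInt (⟨0, 0, 1, 0, -1⟩ : WeierstrassCurve ℚ))
    (hm : m ≠ 0) (hm3 : ∀ q ∈ m.primeFactors, q % 3 = 2) (hℓm : ¬ ℓ ∣ m) (hℓp : ¬ ℓ ∣ p)
    {σ : ringClassField K ι (9 * p * (ℓ * m)) ≃ₐ[ℚ] ringClassField K ι (9 * p * (ℓ * m))}
    (hσ : Subgroup.zpowers σ = ringClassGalOver ι (9 * p * (ℓ * m)) (9 * p * m))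
    {y y₀ : ((⟨0, 0, 1, 0, -1⟩ : WeierstrassCurve ℚ).baseChange (ringClassField K ι (9 * p * (ℓ * m)))).toAffine.Point}
    (hy : Affine.Point.map (W' := (⟨0, 0, 1, 0, -1⟩ : WeierstrassCurve ℚ)) (ringClassField K ι (9 * p * (ℓ * m))).subtype.toRatAlgHom y = Dt.φ (heegnerTau (((ℓ * m : ℕ) : ℤ) ^ 2 * (81 * ((p : ℤ) ^ 2 + 4 * p + 16)), ((ℓ * m : ℕ) : ℤ) * (-(9 * (4 * (p : ℤ) ^ 2 + 17 * p + 72))), 4 * (p : ℤ) ^ 2 + 18 * p + 81)))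
    (hy₀ : Affine.Point.map (W' := (⟨0, 0, 1, 0, -1⟩ : WeierstrassCurve ℚ)) (ringClassField K ι (9 * p * (ℓ * m))).subtype.toRatAlgHom y₀ = Dt.φ (heegnerTau ((m : ℤ) ^ 2 * (81 * ((p : ℤ) ^ 2 + 4 * p + 16)), (m : ℤ) * (-(9 * (4 * (p : ℤ) ^ 2 + 17 * p + 72))), 4 * (p : ℤ) ^ 2 + 18 * p + 81))) :
    ∑ i ∈ Finset.range (ℓ + 1), pointGalHom (⟨0, 0, 1, 0, -1⟩ : WeierstrassCurve ℚ) (ringClassField K ι (9 * p * (ℓ * m))) (σ ^ i) y = 0 := by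
  have hℓ : ℓ.Prime := Fact.out
  have hK := JZero.isImaginaryQuadratic_of_sq_add_self_add_one hω h2
  have hdK := JZero.discr_eq_neg_three_of_sq_add_self_add_one hω h2
  have hinert := JZero.span_natCast_isPrime_of_mod_three_eq_two hω h2 hℓ hℓ3
  have hp0 : p ≠ 0 := by rintro rfl; simp at hp
  have hℓ3' : ℓ ≠ 3 := by rintro rfl; simp at hℓ3
  have hℓf : ¬ ℓ ∣ 9 * p * m := by
    rw [show 9 * p * m = 3 ^ 2 * (p * m) by ring]
    intro h
    rcases (Nat.Prime.dvd_mul hℓ).mp h with h9 | hpm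
    · exact hℓ3' ((Nat.prime_dvd_prime_iff_eq hℓ Nat.prime_three).mp (hℓ.dvd_of_dvd_pow h9))
    · rcases (Nat.Prime.dvd_mul hℓ).mp hpm with h' | h'
      · exact hℓp h'
      · exact hℓm h'
  have hf : 9 * p * m ≠ 0 := mul_ne_zero (mul_ne_zero (by norm_num) hp0) hm
  have hunits : 2 ≤ 9 * p * m ∨ NumberField.discr K < -4 := by
    left
    have h1 : 1 ≤ p * m := Nat.one_le_iff_ne_zero.mpr (mul_ne_zero hp0 hm)
    have h2' : 9 * p * m = 9 * (p * m) := by ring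
    omega
  have hlev : ℓ * (9 * p * m) = 9 * p * (ℓ * m) := by ring
  have hdivℓ : 9 * p * (ℓ * m) / ℓ = 9 * p * m := by
    rw [show 9 * p * (ℓ * m) = 9 * p * m * ℓ by ring, Nat.mul_div_cancel _ hℓ.pos]
  have hσd : Subgroup.zpowers σ = ringClassGalOver ι (9 * p * (ℓ * m)) (9 * p * (ℓ * m) / ℓ) := by
    rw [hdivℓ]; exact hσ
  have ha0 : (⟨0, 0, 1, 0, -1⟩ : WeierstrassCurve ℚ).LFunction ℓ = 0 :=
    JZero.lFunction_eq_zero_of_j_eq_zero_of_mod_three_eq_two _ j_sylvesterNineMinimal hℓ hℓ3 hℓ2 hΔ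
  rw [sum_range_pow_eq_sum_image hK ι hlev hℓ hinert hℓf hf hunits hσd
      (fun g ↦ pointGalHom (⟨0, 0, 1, 0, -1⟩ : WeierstrassCurve ℚ) (ringClassField K ι (9 * p * (ℓ * m))) g y),
    sum_pointGalHom_eq_lFunction_smul_sylvesterTower_left hK hdK ι Dt hp hℓ hℓ3 hm hm3 hℓm hℓp hinert
      (fun g ↦ mem_image_pow_iff_mem_ringClassGalOver hK ι hlev hℓ hinert hℓf hf hunits hσd g) hy hy₀,
    ha0, zero_smul]

/-- **The trace-zero input passes through a commuting derivative operator**: if `σ σ' = σ' σ` and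
`Σ_{i ≤ ℓ} σ^i w = 0` then `Σ_{i ≤ ℓ} σ^i (D_{σ'} w) = 0` (`D_{σ'} = Σ_{k ≤ q} k σ'^k`; Gross 1991 §3: the
`D_ℓ` commute in the abelian `Gal(K[n]/K)`). [cite: GrossLMS1991, §3 (3.5), Prop. 3.7 (1)] -/
theorem sum_pointGalHom_pow_derivOp_eq_zero (W : WeierstrassCurve ℚ) {L : Type} [Field L] [CharZero L]
    [DecidableEq L] {σ σ' : L ≃ₐ[ℚ] L} (hc : Commute σ σ') {ℓ : ℕ} (q : ℕ) {w : (W.baseChange L).toAffine.Point}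
    (hw : ∑ i ∈ Finset.range (ℓ + 1), pointGalHom W L (σ ^ i) w = 0) :
    ∑ i ∈ Finset.range (ℓ + 1), pointGalHom W L (σ ^ i) (KolyvaginOperator.derivOp (pointGalHom W L) σ' q w) = 0 := by
  have hci : ∀ i : ℕ, Commute (σ ^ i) σ' := fun i ↦ hc.pow_left i
  simp_rw [pointGalHom_derivOp_comm W (hci _) q w]
  unfold KolyvaginOperator.derivOp
  rw [Finset.sum_comm]
  refine Finset.sum_eq_zero fun k _ ↦ ?_
  rw [← Finset.smul_sum, ← map_sum, hw, map_zero, smul_zero]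

/-- **The conjugate-wise (ES2) relation passes through a commuting derivative operator** (Gross 1991, proof
of Prop. 6.2 (2): *"for any `σ ∈ 𝒢_n` we conjugate this congruence"*): for a set `S` of automorphisms with
`σ'^k γ ∈ S` for `γ ∈ S` and each `γ ∈ S` commuting with `σ'`, if `red (g • ιL (γ y)) = φ₀ • red (g • ιL (γ y₀))`
for all `γ ∈ S`, `g`, then the same holds for `(D_{σ'} y, D_{σ'} y₀)`.
[cite: GrossLMS1991, Prop. 6.2 (2) (proof, p. 245)] [cite: Nekovar2007, Prop. 4.9] -/
theorem forall_geomReduction_derivOp_of_forall (W : WeierstrassCurve ℚ) {L : Type} [Field L] [CharZero L]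
    {Γ X B : Type*} [Group Γ] [AddCommGroup X] [DistribMulAction Γ X] [AddCommGroup B]
    {Φ : Type*} [SMul Φ B] (φ₀ : Φ) (hφ₀ : ∀ b c : B, φ₀ • (b + c) = φ₀ • b + φ₀ • c) (hφ₀0 : φ₀ • (0 : B) = 0)
    (ιL : (W.baseChange L).toAffine.Point →+ X) (red : X →+ B)
    (S : Set (L ≃ₐ[ℚ] L)) {σ' : L ≃ₐ[ℚ] L} (hS : ∀ γ ∈ S, ∀ k : ℕ, σ' ^ k * γ ∈ S)
    (hcomm : ∀ γ ∈ S, Commute γ σ') (q : ℕ) {y y₀ : (W.baseChange L).toAffine.Point}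
    (h : ∀ γ ∈ S, ∀ g : Γ, red (g • ιL (pointGalHom W L γ y)) = φ₀ • red (g • ιL (pointGalHom W L γ y₀))) :
    ∀ γ ∈ S, ∀ g : Γ,
      red (g • ιL (pointGalHom W L γ (KolyvaginOperator.derivOp (pointGalHom W L) σ' q y))) =
        φ₀ • red (g • ιL (pointGalHom W L γ (KolyvaginOperator.derivOp (pointGalHom W L) σ' q y₀))) := by
  intro γ hγ g
  rw [pointGalHom_derivOp_comm W (hcomm γ hγ) q y, pointGalHom_derivOp_comm W (hcomm γ hγ) q y₀]
  let φ : B →+ B := { toFun := fun b ↦ φ₀ • b, map_zero' := hφ₀0, map_add' := hφ₀ }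
  have key := map_smul_derivOp_eq_of_forall W ιL red φ g σ' q (y := pointGalHom W L γ y)
    (y₀ := pointGalHom W L γ y₀) (fun k ↦ by
      change red (g • ιL (pointGalHom W L (σ' ^ k) (pointGalHom W L γ y))) =
        φ₀ • red (g • ιL (pointGalHom W L (σ' ^ k) (pointGalHom W L γ y₀)))
      have e : ∀ w, pointGalHom W L (σ' ^ k) (pointGalHom W L γ w) = pointGalHom W L (σ' ^ k * γ) w :=
        fun w ↦ by rw [map_mul]; rfl
      rw [e, e]
      exact h _ (hS γ hγ k) g)
  exact key

end Summit.BirchSwinnertonDyer.BirchSwinnertonDyer.Theorems.SylvesterTwoCMFlip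

end
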